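/- Copyright: the b2b-balaban cell (near-miss cell 7), T⁴-continuum fan-out; row NE7b CRUX team (2), OWNER seat
t4-ne7b-p1 (gen 54) — (α)-JOINT AT THE CENSUS LETTERS, part 1: the no-region reading with level-dependent sizes AT ANY RECORD
DIMENSION `d`.  Released under the licence of the surrounding project. -/
import Summits.QuantumFields.BalabanUV.T4Continuum.Support.HistoryRealiseCellsRunAssemblyWTVSJointReading

/-!
# (α)-JOINT AT THE CENSUS LETTERS, part 1: `ℛ₆ d L R` — THE NO-REGION READING WITH LEVEL-DEPENDENT SIZES AT ANY RECORD
DIMENSION `d`, AND ITS LETTERS `Φ₇` (owner lineage `t4-ne7b-p1` gen 54; sequel of IR-54-1 (J3b-1) `…JointReading`)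

Summits-side support leaf of the T⁴-continuum cell (rung (B)+1 on a FINITE torus only; NOT infinite volume, NOT the
mass gap, NOT Clay; NOT a proof of NE7b — the cell's OWN estimate, NOT PRINTED, NOT PROVED).  [folklore] `…JointReading`'s
`ℛ₅ L R : HistReading Isk 1` and `Φ₆ : HistFactors Isk 1` VERBATIM with the record dimension a PARAMETER `d` (labels
`Lab d`); the twelve display lemmas and `factorRead_toy₇` ∕ `histRead_toy₇` ∕ `BA_le_of_le₇` with the same proofs.  Two
`def`s, nothing printed asserted, no `def … : Prop` fact, no cite-tagged hypothesis, zero `sorry`.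

WHY.  IR-54-1's joint witness (`…JointWitness.continuumYM4Torus_jointData`, p306709) runs at record dimension `d = 1` and
`L = 87781` — SOME admissible letters.  The cell's CENSUS letters are `d = 4`, `L = 13`, `M = 13`, collar `c = 32`
(ROW-NE7b-STATE §4; balaban-calc VOLUME-k ∕ G40), and print's `β₀ = 1∕7` ([B16] p. 389 «for example, take β₀ = 1∕7»).
Part 3 (`…JointWitness13`) re-runs the joint witness AT THOSE LETTERS; it needs the no-region reading and the record
constructor at `d = 4` — typed here once for every `d`.

HONEST.  Bookkeeping over OUR carriers; the reading names NO region (every H3-side field it feeds is VACUOUS BY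
DESIGN).  Nothing of Bałaban's is discharged; every R-class row of the wall stays; NE7b NOT PRINTED ∕ NOT PROVED; spine
0∕9.  HONEST DEPENDENCY (cell): continuum YM on T⁴ ⇐ BetaPertH ∧ nine spine estimates (0/9 proved); BetaPertH ⇐ (D1)
∧ (D4) ∧ CAP+tail; G-an2-4 gates asym, D1 and NE2/3/4.  Unchanged here.
-/

open Finset MeasureTheory
open Literature.MathematicalPhysics.QuantumFieldTheory.Balaban1983to89
open Literature.MathematicalPhysics.QuantumFieldTheory.Balaban1983to89.B16SProfile (DropCtl)
open T4PersistenceDictionary T4PersistentHistoryCount T4BankedInduction T4PrintedShapeBanking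
open T4WeightBudget T4GlobalDenominator T4LiveClassFibration T4LiveStructureGas T4LiveGasToTerms T4RecordPriceSeam
open T4PartnerMultiplicity T4IndicatorShell T4MatchingAssembly T4MatchingClosure T4MatchingClosureSocket T4Continuum
open T4StabilitySocket T4BranchingRecordsGas T4TaggedShapeBanking T4CanonicalMenus T4RenewalChains
open Summit.QuantumFields.BalabanUV.T4Continuum.HistoryFlow Summit.QuantumFields.BalabanUV.T4Continuum.HistoryGen
open Summit.QuantumFields.BalabanUV.T4Continuum.HistoryAdmissible
open Summit.QuantumFields.BalabanUV.T4Continuum.HistoryGenealogyExtraction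
open Summit.QuantumFields.BalabanUV.T4Continuum.HistoryGenealogyRealise
open Summit.QuantumFields.BalabanUV.T4Continuum.HistoryGenealogyInstantiate
open Summit.QuantumFields.BalabanUV.T4Continuum.HistoryGenealogyPedigree
open Summit.QuantumFields.BalabanUV.T4Continuum.HistoryAssemblyPedigree Summit.QuantumFields.BalabanUV.T4Continuum.HistoryAssemblyTerms
open Summit.QuantumFields.BalabanUV.T4Continuum.HistoryAssemblyMult Summit.QuantumFields.BalabanUV.T4Continuum.HistoryAssemblyMultKey
open Summit.QuantumFields.BalabanUV.T4Continuum.HistoryAssemblyRealiseRun Summit.QuantumFields.BalabanUV.T4Continuum.HistorySocketTH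
open Summit.QuantumFields.BalabanUV.T4Continuum.HistoryRealiseDistinct
open Summit.QuantumFields.BalabanUV.T4Continuum.HistoryRealiseCellsRunApexT3bWTVS
open Summit.QuantumFields.BalabanUV.T4Continuum.B16HistoryIndexedRepr
open Summit.QuantumFields.BalabanUV.T4Continuum.B16HistoryIndexedTrunc
open Summit.QuantumFields.BalabanUV.T4Continuum.HistoryBankingLE Summit.QuantumFields.BalabanUV.T4Continuum.HistoryBankingVolumePlug
open Summit.QuantumFields.BalabanUV.T4Continuum.HistoryConstants Summit.QuantumFields.BalabanUV.T4Continuum.HistoryBankingDiscountCharge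
open Summit.QuantumFields.BalabanUV.T4Continuum.HistoryBankingCreditRead Summit.QuantumFields.BalabanUV.T4Continuum.HistoryBankingFibreRoom
open Summit.QuantumFields.BalabanUV.T4Continuum.HistoryPriceNodeSum Summit.QuantumFields.BalabanUV.T4Continuum.HistoryPriceKeys
open Summit.QuantumFields.BalabanUV.T4Continuum.HistoryRealiseCellsRunSupplyWTVS
open Summit.QuantumFields.BalabanUV.T4Continuum.HistoryRealiseCellsRunSupplyKeysWTVS
open Summit.QuantumFields.BalabanUV.T4Continuum.HistoryRealiseCellsRunSupplyWTVSSanity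
open Summit.QuantumFields.BalabanUV.T4Continuum.HistoryRealiseCellsRunSupplyKeysWTVSSanity
open Summit.QuantumFields.BalabanUV.T4Continuum.HistoryRealiseCellsRunAssemblyWTVSData
open Summit.QuantumFields.BalabanUV.T4Continuum.HistoryRealiseCellsRunAssemblyWTVS
open Summit.QuantumFields.BalabanUV.T4Continuum.HistoryRealiseCellsRunAssemblyWTVSDataL
open Summit.QuantumFields.BalabanUV.T4Continuum.HistoryRealiseCellsRunAssemblyWTVSDataLW
open Summit.QuantumFields.BalabanUV.T4Continuum.HistoryRealiseCellsRunAssemblyWTVSDataLWL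
open Summit.QuantumFields.BalabanUV.T4Continuum.HistoryRealiseCellsRunAssemblyWTVSSanity
open Summit.QuantumFields.BalabanUV.T4Continuum.HistoryRealiseCellsRun (runProfile_succ_le)
open Summit.QuantumFields.BalabanUV.T4Continuum.HistoryBankingSharpShares (ell sBsharp)
open Summit.QuantumFields.BalabanUV.T4Continuum.HistoryBankingRoundingUnrounded (sRunr ApFlat)
open Summit.QuantumFields.BalabanUV.T4Continuum.HistoryBankingVolumeWindowLattice (uvolL uvolL_nonneg uvolL_eq_mul_uvol)

open Summit.QuantumFields.BalabanUV.T4Continuum.HistoryRealiseCellsRunAssemblyWTVSJointReading (two_le_of_isRj flowRows_of_tuned)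

namespace Summit.QuantumFields.BalabanUV.T4Continuum.HistoryRealiseCellsRunAssemblyWTVSJointReadingD

noncomputable section

-- the structural `DecidableEq` instance of the concrete tag type exceeds the default synthesis size (as in the siblings)
set_option synthInstance.maxSize 1024

open B16HistoryIndexedRepr.Sanity B16HistoryIndexedRepr.SanityInput HistoryConstants.Sanity HistoryBankingCreditRead.Sanity

/-! ## §1 The no-region reading with level-dependent sizes, at record dimension `d` -/

/-- **THE NO-REGION READING AT BLOCKING PARAMETER `L` WITH SIZES `R K t`**: no new region, no new field; exponents
`s := runProfile L R` ((c1) BY CONSTRUCTION), memory `Rm ≡ 2`.  `…JointReading.ℛ₅ L R` is the case `d := 1`.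
[folklore] -/
def ℛ₆ (d L : ℕ) (R : ℕ → ℕ → ℕ) : HistReading Isk d where
  L := L
  s := runProfile L R
  R := R
  Rm _ _ _ := 2
  N _ _ _ _ := ∅
  cls _ _ _ _ := 0
  F _ _ _ _ := ∅

variable (d L : ℕ) (R : ℕ → ℕ → ℕ)

/-- the runs read off `ℛ₆ d L R` name no region, hence have no component at any level [folklore] -/
theorem comp_run_eq_empty₆ (K : ℕ) (τ : HIndex.Idx Isk) (j : ℕ) : ((ℛ₆ d L R).inputOf.run K τ).histV.comp j = ∅ :=
  ((ℛ₆ d L R).inputOf.run K τ).comp_histV_eq_empty_of_N (fun _ => rfl) j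

/-- nor has the real bookkeeping of the run read off a history choice [folklore] -/
theorem compM_runOf_eq_empty₆ (K : ℕ) (a : (Isk K).Adm) (ι : (Isk K).HZ × (Isk K).HL × (Isk K).HC) (j : ℕ) :
    ((ℛ₆ d L R).runOf K a ι).histM.comp j = ∅ :=
  ((ℛ₆ d L R).runOf K a ι).comp_histM_eq_empty_of_N (fun _ => rfl) j

/-- nothing dies [folklore] -/
theorem died_run_eq_empty₆ (K : ℕ) (τ : HIndex.Idx Isk) (j : ℕ) : ((ℛ₆ d L R).inputOf.run K τ).histV.died j = ∅ :=
  ((ℛ₆ d L R).inputOf.run K τ).died_histV_eq_empty_of_N (fun _ => rfl) j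

/-- no live name at any cutoff [folklore] -/
theorem liveCV_eq_empty₆ (K : ℕ) (τ : HIndex.Idx Isk) : (ℛ₆ d L R).inputOf.liveCV K τ = ∅ := by
  show (((ℛ₆ d L R).inputOf.run K τ).histV.comp K).image (Prod.mk K) = ∅
  rw [comp_run_eq_empty₆, Finset.image_empty]

/-- `NewOK` (vacuous) [folklore] -/
theorem newOK_run₆ (K : ℕ) (τ : HIndex.Idx Isk) : ((ℛ₆ d L R).inputOf.run K τ).NewOK :=
  ⟨fun _ _ hn => by simp [HistReading.inputOf, ℛ₆] at hn⟩

/-- `NewDisjoint` (vacuous) [folklore] -/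
theorem newDisjoint_run₆ (K : ℕ) (τ : HIndex.Idx Isk) : ((ℛ₆ d L R).inputOf.run K τ).NewDisjoint :=
  fun _ _ hn => by simp [HistReading.inputOf, ℛ₆] at hn

/-- `RegionsInBox` (vacuous) [folklore] -/
theorem regionsInBox_run₆ (n K : ℕ) (τ : HIndex.Idx Isk) : ((ℛ₆ d L R).inputOf.run K τ).RegionsInBox n K :=
  fun _ _ _ hn => by simp [HistReading.inputOf, ℛ₆] at hn

variable {R} in
/-- memory domination `Rm ≤ R` from `2 ≤ R K t` [folklore] -/
theorem rm_le_run₆ (hR2 : ∀ K t, 2 ≤ R K t) (K : ℕ) (τ : HIndex.Idx Isk) :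
    ∀ t k, ((ℛ₆ d L R).inputOf.run K τ).Rm t k ≤ ((ℛ₆ d L R).inputOf.run K τ).R t := fun _ _ => hR2 _ _

variable {R} in
/-- its one-step form [folklore] -/
theorem rmS_run₆ (hR2 : ∀ K t, 2 ≤ R K t) (K : ℕ) (τ : HIndex.Idx Isk) :
    ∀ t k, ((ℛ₆ d L R).inputOf.run K τ).Rm t (k + 1) ≤ ((ℛ₆ d L R).inputOf.run K τ).R (t + 1) := fun _ _ => hR2 _ _

/-- non-degenerate memory [folklore] -/
theorem rm2_run₆ (K : ℕ) (τ : HIndex.Idx Isk) : ∀ t, 2 ≤ ((ℛ₆ d L R).inputOf.run K τ).Rm t 1 := fun _ => le_rfl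

/-- no bad term [folklore] -/
theorem not_mem_badTerms₆ {γ : Type*} [DecidableEq γ] (cellOf : ℕ → HIndex.Idx Isk → ℕ × Lab d → γ) (jstar : ℕ → ℕ)
    (K : ℕ) (τ : HIndex.Idx Isk) :
    τ ∉ badTerms (memOf (ℛ₆ d L R).inputOf.pedV (ℛ₆ d L R).inputOf.liveCV cellOf) jstar (HIndex.termSet Isk) K := by
  intro h
  have h' := (Finset.mem_filter.1 h).2
  unfold memOf at h'
  rw [liveCV_eq_empty₆, Finset.image_empty] at h'
  simp at h'

/-- no bad key class [folklore] -/
theorem not_mem_badGMems₆ {γ δ : Type*} [DecidableEq γ] [DecidableEq δ] (cellOf : ℕ → HIndex.Idx Isk → ℕ × Lab d → γ)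
    (phys : ℕ → HIndex.Idx Isk → ℕ × Lab d → δ) (jstar : ℕ → ℕ) (K : ℕ) (k : Finset (γ × Gen PEv × δ)) :
    k ∉ badGMems (memOf (ℛ₆ d L R).inputOf.pedV (ℛ₆ d L R).inputOf.liveCV cellOf) jstar (HIndex.termSet Isk)
      (kmemOf (ℛ₆ d L R).inputOf.pedV (ℛ₆ d L R).inputOf.liveCV cellOf phys) K := by
  intro h
  obtain ⟨τ, hτ, -⟩ := Finset.mem_image.1 h
  exact not_mem_badTerms₆ d L R cellOf jstar K τ hτ

/-! ## §2 Toy letters with the renewal exponent at the level-dependent sizes, at record dimension `d` -/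

section Letters

variable (d : ℕ) (O : PrintedO1s) (m : ℝ) (C : T4PrintedShapeBanking.Consts) (Lr : ℝ) (p₁ : ℕ) (R : ℕ → ℕ → ℕ)
  (g : ℕ → ℕ → ℝ) (Z : ℕ → ℝ → ℝ) (Λ : ℕ → ℕ → ℝ)

/-- **TOY FACTOR DATA AT ANY LEVEL COST `Λ`, RENEWAL LETTER AT THE SIZES `R K`**: `…JointReading.Φ₆` at record dimension `d`. [folklore] -/
def Φ₇ (hΛ1 : ∀ K t, 1 ≤ Λ K t) : HistFactors Isk d where
  fB K j d _ := Real.exp (-sBsharp O m C (g K) j d)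
  fR K h := Real.exp (-sRunr O.γ₀ O.A₁ O.M Lr O.β₀ O.d p₁ (R K) (g K) h)
  Λ := Λ
  one_le_Λ := hΛ1
  wZ _ _ _ _ := 1
  wY _ _ _ _ := 1
  wC _ _ _ _ := 1
  BA K t := Real.log (Z K t / 6)
  BV _ _ _ _ _ _ := 0

variable (hΛ1 : ∀ K t, 1 ≤ Λ K t)

/-- the factor reading holds at the letter `S_h` read at `(ℛ₆ d L R).R K = R K` — with equality [folklore] -/
theorem factorRead_toy₇ (L K : ℕ) :
    FactorRead ((Φ₇ d O m C Lr p₁ R g Z Λ hΛ1).fB K) ((Φ₇ d O m C Lr p₁ R g Z Λ hΛ1).fR K) (sBsharp O m C (g K))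
      (sRunr O.γ₀ O.A₁ O.M Lr O.β₀ O.d p₁ ((ℛ₆ d L R).R K) (g K)) :=
  factorRead_exp _ _

/-- `HistRead` holds for `Φ₇` and the toy expansions on `ℛ₆ d L R` (empty forest; envelopes attained). [folklore] -/
theorem histRead_toy₇ (L : ℕ) : HistRead (ℛ₆ d L R) (Φ₇ d O m C Lr p₁ R g Z Λ hΛ1) (fun K t => toyR (Z K t)) 1 0 where
  χ01 _ _ _ _ := ⟨zero_le_one, le_rfl⟩
  tz_le _ _ _ _ _ _ _ _ := le_of_eq rfl
  ty_le _ _ _ _ _ _ _ _ := le_of_eq rfl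
  tc_le _ _ _ _ _ _ _ _ := le_of_eq rfl
  A'_le _ _ _ _ _ := le_rfl
  Vs_le _ _ _ _ _ _ _ _ _ := le_rfl
  forest_le K t _ _ a ι _ := by
    show (1 : ℝ) * 1 ≤ _
    rw [Finset.prod_congr rfl fun j _ => by rw [compM_runOf_eq_empty₆ d L R K a ι j, Finset.prod_empty],
      Finset.prod_const_one]
    norm_num

variable {Z} in
/-- the completed-action envelope is bounded along `|t| ≤ 1` by `log (Zi∕6)` [folklore] -/
theorem BA_le_of_le₇ {Zi : ℝ} (hpos : ∀ K t, |t| ≤ 1 → 0 < Z K t) (hle : ∀ K t, |t| ≤ 1 → Z K t ≤ Zi) (K : ℕ) {t : ℝ}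
    (ht : |t| ≤ 1) : (Φ₇ d O m C Lr p₁ R g Z Λ hΛ1).BA K t ≤ Real.log (Zi / 6) :=
  Real.log_le_log (by have := hpos K t ht; positivity) (by have := hle K t ht; linarith)

end Letters

end

end Summit.QuantumFields.BalabanUV.T4Continuum.HistoryRealiseCellsRunAssemblyWTVSJointReadingD
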